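import Mathlib.Data.Int.LeastGreatest
import Summits.ABC.IUTFork.Cor312RamifiedEShells
import Summits.ABC.IUTFork.Cor312IdentifiedNonVacuity
import HarnessLib

/-!
# [IUTchIII] Cor. 3.12 — the RAMIFIED SHEAR bed at GENERAL ramification index `e`, II: the frame of 𝒪_L-polydiscs
# and the log-volume `μ(π^k·𝒪_L) = −(k/e)·log p`

Record-only file (D-0012; MODEL DATA `box`/`rFrame`/`rVol`, then proofs; no `Prop` fact, nothing asserted about print) of
the abc-iut cell, IUT REPAIR BRANCH (rung LADDER-ABC:A2.RP), seat abc-iut-rp-m1 (gen 4; class (ii) = Mochizuki's replies). TAKES NO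
SIDE on [IUTchIII] Cor. 3.12. Sequel to `Cor312RamifiedEShells` (rank-`e` shells `ramShellsE p e` for the totally ramified
`K = ℚ_p(π)`, `π^e = p`; Ism = ALL lattice automorphisms `GL_e(ℤ_(p))` — the Dupuy–Hilado reading [cite: DupuyHilado2025, §4.9],
declared stronger than print's [IUTchII] Ex. 1.8 (iv); tensor coordinates `coord x ε`, `ε : S^±_{j+1} → {0,…,e−1}`;
`actsIntegrally_of_mem_closure`; the reversal family `revFam`). It generalises the seat's gen-3 `Cor312RamifiedPolydiscs` (`e = 2`)
— the lineage's booked «OPEN-for-successor» item on row RP-M47 of HOME/plan/repair/CANDIDATES.tsv ([Rpt2018] (VUC3) p. 14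
l. 11–32, (†ΘCR) p. 16 l. 58–66, (SSIdFs) p. 16 l. 68–70: «(Ind1), (Ind2) cannot be eliminated»).

§1 THE POLYDISCS. `wt ε = Σ_i ε(i)` (the `π`-adic valuation of the basis monomial `e_ε = ⊗_i π^{ε(i)}`, `0 ≤ wt ε ≤ (j+1)(e−1) =
wmax`) and **`box k := {x | ∀ ε, x_ε = 0 ∨ e·v_p(x_ε) + wt ε ≥ k}`**: the monomial `x_ε·e_ε` read in `K^{⊗(j+1)}` has `π`-adic
valuation `e·v_p(x_ε) + wt ε`, and `box k` — the `ℤ_(p)`-span of the monomial terms of valuation `≥ k` — STANDS FOR the polydisc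
`π^k·𝒪_L` of the étale algebra `L = K^{⊗_{ℚ_p}(j+1)}` pulled back to tensor coordinates (EXACTLY it for `e = 2`, `p` odd: gen 3's
`Cor312RamifiedPolydiscs`; in general the declared model); `box 0 ⊋ 𝕀 = ⊗^{j+1} 𝒪_K = {all x_ε ∈ ℤ_(p)}` (different-sized index).
The boxes are a CHAIN (`box_subset_iff`) of hull-sets of EQUAL radii (declared sub-frame, as in gen 3). §2 the frame `rFrame` and
the log-volume **`μ(box k) = −(k/e)·log p`** (one `π`-step = `(1/e)·log p`; packet-normalised, [IUTchIII] Prop. 3.9 (i)–(ii)).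

Sequel `Cor312RamifiedEOrbitHull`: the EXACT hull of an (Ind1),(Ind2)-orbit of a box (`box (e·⌈(k − (j+1)(e−1))/e⌉)`), then
`Cor312RamifiedESetting`: the setting RAM_e(p, m) and its two printed quantities. Interface-level toy over `toyIndex`; not a model of
initial Θ-data; no judgement on print. [claim: Mochizuki2012, status: disputed]
-/

noncomputable section

namespace Summit.ABC.IUTFork.Cor312Vol.RamifiedEWitness

open Set Thm311 Cor312 Cor312.Checks Cor312.IdentifiedNonVacuity NaiveWitness Literature.IUT.LogThetaLattice
open RamifiedWitness (PLe IsPInt ple_zero isPInt_one fib eq_fib ple_ppow_iff)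

variable (p e : ℕ)

/-! ## 1. Weights and the polydiscs `box k = π^k·𝒪_L` in tensor coordinates -/

/-- The WEIGHT of a tensor index `ε : S^±_{j+1} → {0,…,e−1}`: `Σ_i ε(i)`, the `π`-adic valuation of the basis monomial
`e_ε = ⊗_i π^{ε(i)}`. [folklore] -/
def wt {j : toyIndex.Label} (ε : toyIndex.Caps j → Fin e) : ℕ := ∑ i, ((ε i : Fin e) : ℕ)

/-- The MAXIMAL WEIGHT `(j+1)·(e−1)` at label `j` (as an integer). [folklore] -/
def wmax (j : toyIndex.Label) : ℤ := (((j : ℕ) + 1 : ℕ) : ℤ) * ((e : ℤ) - 1)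

variable {e} in
/-- `wt ε ≤ (j+1)(e−1)`. [folklore] -/
theorem wt_le {j : toyIndex.Label} (ε : toyIndex.Caps j → Fin e) : (wt e ε : ℤ) ≤ wmax e j := by
  unfold wt wmax
  have h : ∀ i, (((ε i : Fin e) : ℕ) : ℤ) ≤ (e : ℤ) - 1 := fun i => by have := (ε i).isLt; omega
  calc ((∑ i, ((ε i : Fin e) : ℕ) : ℕ) : ℤ) = ∑ i, (((ε i : Fin e) : ℕ) : ℤ) := by push_cast; rfl
    _ ≤ ∑ _i : toyIndex.Caps j, ((e : ℤ) - 1) := Finset.sum_le_sum fun i _ => h i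
    _ = (((j : ℕ) + 1 : ℕ) : ℤ) * ((e : ℤ) - 1) := by
      rw [Finset.sum_const, Finset.card_univ, nsmul_eq_mul, Fintype.card_fin]

/-- `0 ≤ wmax` for `e ≥ 1`. [folklore] -/
theorem wmax_nonneg (he : 1 ≤ e) (j : toyIndex.Label) : 0 ≤ wmax e j := by
  unfold wmax
  exact mul_nonneg (by positivity) (by omega)

/-- The index `(1, …, 1)` of the basis monomial `1 ⊗ ⋯ ⊗ 1` (all exponents `0`, weight `0`). [folklore] -/
def zeros [NeZero e] (j : toyIndex.Label) : toyIndex.Caps j → Fin e := fun _ => 0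

/-- The index `(π^{e−1}, …, π^{e−1})` of the `p`-adically smallest basis monomial (weight `(j+1)(e−1)`). [folklore] -/
def tops [NeZero e] (j : toyIndex.Label) : toyIndex.Caps j → Fin e := fun _ => Fin.rev 0

/-- The index `(π^c, 1, …, 1)` (weight `c`). [folklore] -/
def idx1 [NeZero e] (j : toyIndex.Label) (c : Fin e) : toyIndex.Caps j → Fin e := fun i => if i = 0 then c else 0

/-- `wt (1,…,1) = 0`. [folklore] -/
@[simp] theorem wt_zeros [NeZero e] (j : toyIndex.Label) : wt e (zeros e j) = 0 := by simp [wt, zeros]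

/-- `wt (π^{e−1},…,π^{e−1}) = (j+1)(e−1)`. [folklore] -/
theorem wt_tops [NeZero e] (j : toyIndex.Label) : (wt e (tops e j) : ℤ) = wmax e j := by
  have he := NeZero.one_le (n := e)
  have hr : ((Fin.rev (0 : Fin e) : Fin e) : ℕ) = e - 1 := by simp [Fin.val_rev]
  unfold wt tops wmax
  rw [Finset.sum_const, Finset.card_univ, smul_eq_mul, Fintype.card_fin, hr, Nat.cast_mul, Nat.cast_sub he]
  push_cast
  ring

/-- `wt (π^c,1,…,1) = c`. [folklore] -/
@[simp] theorem wt_idx1 [NeZero e] (j : toyIndex.Label) (c : Fin e) : wt e (idx1 e j c) = (c : ℕ) := by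
  unfold wt idx1
  rw [Finset.sum_eq_single (0 : toyIndex.Caps j)]
  · simp
  · intro i _ hi; simp [hi]
  · intro h; exact absurd (Finset.mem_univ _) h

/-- The reversal applied to every factor turns `(π^{e−1},…,π^{e−1})` into `(1,…,1)`. [folklore] -/
theorem rev_tops [NeZero e] (j : toyIndex.Label) : (fun i => Fin.rev (tops e j i)) = zeros e j := by
  funext i; simp [tops, zeros, Fin.rev_rev]

/-- **The POLYDISC `box k`** (standing for `π^k·𝒪_L` in tensor coordinates, see the module docstring): every monomial term `x_ε·e_ε` has
`π`-adic valuation `e·v_p(x_ε) + wt ε ≥ k` (junk-free: `x_ε = 0` allowed explicitly, since Mathlib's `padicValRat p 0 = 0`).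
[claim: Mochizuki2012, status: disputed] -/
def box (j : toyIndex.Label) (vQ : toyIndex.VQ) (k : ℤ) : Set ((ramShellsE p e).Packet j vQ) :=
  {x | ∀ ε, coord p e j vQ x ε = 0 ∨ k ≤ (e : ℤ) * padicValRat p (coord p e j vQ x ε) + wt e ε}

variable {p e}

/-- Membership in `box k` (definitional unfolding). [folklore] -/
theorem mem_box_iff {j : toyIndex.Label} {vQ : toyIndex.VQ} (k : ℤ) (x : (ramShellsE p e).Packet j vQ) :
    x ∈ box p e j vQ k ↔ ∀ ε, coord p e j vQ x ε = 0 ∨ k ≤ (e : ℤ) * padicValRat p (coord p e j vQ x ε) + wt e ε :=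
  Iff.rfl

/-- `0 ∈ box k`. [folklore] -/
theorem zero_mem_box (j : toyIndex.Label) (vQ : toyIndex.VQ) (k : ℤ) : (0 : (ramShellsE p e).Packet j vQ) ∈ box p e j vQ k :=
  fun ε => Or.inl (coord_zero p e j vQ ε)

/-- The boxes are NESTED: `box k ⊆ box k'` for `k' ≤ k`. [folklore] -/
theorem box_mono (j : toyIndex.Label) (vQ : toyIndex.VQ) {k k' : ℤ} (h : k' ≤ k) : box p e j vQ k ⊆ box p e j vQ k' :=
  fun _ hx ε => (hx ε).imp id fun h' => h.trans h'

section WithPrime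

variable [hp : Fact p.Prime]

/-- `p^a · e_ε ≠ 0`. [folklore] -/
theorem ppow_smul_tb_ne_zero (j : toyIndex.Label) (vQ : toyIndex.VQ) (a : ℤ) (ε : toyIndex.Caps j → Fin e) :
    (p : ℚ) ^ a • tb p e j vQ ε ≠ 0 :=
  smul_ne_zero (ppow_ne_zero p a) ((tb p e j vQ).ne_zero ε)

/-- **Scaling by `p^a` shifts the box index by `e·a`** (`p = π^e`): `p^a·x ∈ box k ⟺ x ∈ box (k − e·a)`. [folklore] -/
theorem ppow_smul_mem_box_iff {j : toyIndex.Label} {vQ : toyIndex.VQ} (a k : ℤ) (x : (ramShellsE p e).Packet j vQ) :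
    (p : ℚ) ^ a • x ∈ box p e j vQ k ↔ x ∈ box p e j vQ (k - e * a) := by
  refine forall_congr' fun ε => ?_
  rw [coord_smul]
  rcases eq_or_ne (coord p e j vQ x ε) 0 with h0 | h0
  · rw [h0, mul_zero]
    exact ⟨fun _ => Or.inl rfl, fun _ => Or.inl rfl⟩
  have h1 : (p : ℚ) ^ a * coord p e j vQ x ε ≠ 0 := mul_ne_zero (ppow_ne_zero p a) h0
  rw [padicValRat.mul (ppow_ne_zero p a) h0, padicValRat_ppow, mul_add]
  constructor
  · rintro (h | h)
    · exact absurd h h1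
    · exact Or.inr (by omega)
  · rintro (h | h)
    · exact absurd h h0
    · exact Or.inr (by omega)

/-- **The scaled basis monomial `p^a·e_ε` lies in `box k` iff `k ≤ e·a + wt ε`.** [folklore] -/
theorem ppow_smul_tb_mem_box_iff {j : toyIndex.Label} {vQ : toyIndex.VQ} (a k : ℤ) (ε : toyIndex.Caps j → Fin e) :
    (p : ℚ) ^ a • tb p e j vQ ε ∈ box p e j vQ k ↔ k ≤ e * a + wt e ε := by
  constructor
  · intro h
    rcases h ε with h1 | h1
    · rw [coord_smul, coord_tb, if_pos rfl, mul_one] at h1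
      exact absurd h1 (ppow_ne_zero p a)
    · rwa [coord_smul, coord_tb, if_pos rfl, mul_one, padicValRat_ppow] at h1
  · intro h ε'
    rw [coord_smul, coord_tb]
    split_ifs with h'
    · subst h'; rw [mul_one, padicValRat_ppow]; exact Or.inr h
    · exact Or.inl (mul_zero _)

/-- Every box has an element outside the next smaller box (a monomial of valuation exactly `k = e·⌊k/e⌋ + (k mod e)`), `e ≥ 1`.
[folklore] -/
theorem exists_mem_box_not_mem_succ [NeZero e] (j : toyIndex.Label) (vQ : toyIndex.VQ) (k : ℤ) :
    ∃ x ∈ box p e j vQ k, x ∉ box p e j vQ (k + 1) := by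
  have he : 0 < (e : ℤ) := by exact_mod_cast Nat.pos_of_ne_zero (NeZero.ne e)
  have h1 := Int.mul_ediv_add_emod k e
  have h2 := Int.emod_nonneg k he.ne'
  have h3 := Int.emod_lt_of_pos k he
  have hc : (k % e).toNat < e := by
    have : ((k % e).toNat : ℤ) < e := by rw [Int.toNat_of_nonneg h2]; exact h3
    exact_mod_cast this
  have hwt : (wt e (idx1 e j ⟨(k % e).toNat, hc⟩) : ℤ) = k % e := by
    rw [wt_idx1]
    exact Int.toNat_of_nonneg h2
  refine ⟨(p : ℚ) ^ (k / e) • tb p e j vQ (idx1 e j ⟨(k % e).toNat, hc⟩), (ppow_smul_tb_mem_box_iff _ _ _).2 ?_,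
    fun h' => ?_⟩
  · rw [hwt]; omega
  · rw [ppow_smul_tb_mem_box_iff, hwt] at h'; omega

/-- **`box k ⊆ box k'` iff `k' ≤ k`** (`e ≥ 1`). [folklore] -/
theorem box_subset_iff [NeZero e] (j : toyIndex.Label) (vQ : toyIndex.VQ) (k k' : ℤ) :
    box p e j vQ k ⊆ box p e j vQ k' ↔ k' ≤ k := by
  refine ⟨fun h => ?_, box_mono j vQ⟩
  by_contra hk
  obtain ⟨x, hx, hx'⟩ := exists_mem_box_not_mem_succ (p := p) (e := e) j vQ k
  exact hx' (box_mono j vQ (by omega) (h hx))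

/-- `k ↦ box k` is injective (`e ≥ 1`). [folklore] -/
theorem box_injective [NeZero e] (j : toyIndex.Label) (vQ : toyIndex.VQ) : Function.Injective (box p e j vQ) := fun k k' h =>
  le_antisymm ((box_subset_iff j vQ k' k).1 h.symm.le) ((box_subset_iff j vQ k k').1 h.le)

omit hp in
/-- A nonzero vector lies outside all sufficiently small boxes: if `A ∋ x ≠ 0` then the indices `k` with `A ⊆ box k` are bounded
above. [folklore] -/
theorem bddAbove_of_ne_zero {j : toyIndex.Label} {vQ : toyIndex.VQ} {A : Set ((ramShellsE p e).Packet j vQ)}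
    {x : (ramShellsE p e).Packet j vQ} (hxA : x ∈ A) (hx : x ≠ 0) : ∃ b : ℤ, ∀ k, A ⊆ box p e j vQ k → k ≤ b := by
  have hε : ∃ ε, coord p e j vQ x ε ≠ 0 := by
    by_contra h
    push Not at h
    exact hx (eq_zero_of_coord_eq_zero p e j vQ h)
  obtain ⟨ε, hε⟩ := hε
  refine ⟨e * padicValRat p (coord p e j vQ x ε) + wt e ε, fun k hk => ?_⟩
  rcases (hk hxA) ε with h | h
  · exact absurd h hε
  · exact h

omit hp in
/-- **The smallest box containing a bounded set with a nonzero element EXISTS** ("the smallest subset of the form `λ·𝒪` that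
contains" it, [IUTchIII] Rmk. 3.9.5 (i)). [folklore] -/
theorem exists_greatest_box {j : toyIndex.Label} {vQ : toyIndex.VQ} {A : Set ((ramShellsE p e).Packet j vQ)}
    (hb : ∃ k, A ⊆ box p e j vQ k) (hne : ∃ x ∈ A, x ≠ 0) :
    ∃ K, A ⊆ box p e j vQ K ∧ ∀ k, A ⊆ box p e j vQ k → k ≤ K := by
  obtain ⟨x, hxA, hx⟩ := hne
  obtain ⟨K, hK, hmax⟩ := Int.exists_greatest_of_bdd (P := fun k => A ⊆ box p e j vQ k) (bddAbove_of_ne_zero hxA hx) hb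
  exact ⟨K, hK, hmax⟩

end WithPrime

/-! ## 2. The frame of polydiscs and the log-volume `μ(box k) = −(k/e)·log p` -/

variable (p e)

/-- **The HULL FRAME of 𝒪_L-polydiscs** on a packet of the ramified shells of index `e`: hull-sets the boxes `box k`, `k ∈ ℤ`;
"relatively compact" = inside some box; "admits a hull" = contains a nonzero vector (then the smallest box containing a bounded such
set exists, `exists_greatest_box`). [claim: Mochizuki2012, status: disputed] -/
def rFrame [Fact p.Prime] (j : toyIndex.Label) (vQ : toyIndex.VQ) : HullFrame ((ramShellsE p e).Packet j vQ) where
  Hul := Set.range (box p e j vQ)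
  IsBounded := fun U => ∃ k, U ⊆ box p e j vQ k
  HasHull := fun U => ∃ x ∈ U, x ≠ 0
  hul_bounded := by rintro _ ⟨k, rfl⟩; exact ⟨k, subset_rfl⟩
  bounded_mono := fun U U' hUU' ⟨k, hk⟩ => ⟨k, hUU'.trans hk⟩
  exists_hul := fun U ⟨k, hk⟩ => ⟨box p e j vQ k, ⟨k, rfl⟩, hk⟩
  hull_mem := by
    intro U hb hne
    obtain ⟨K, hK, hmax⟩ := exists_greatest_box hb hne
    refine ⟨K, (sInter_eq_of_least (S := {H | H ∈ Set.range (box p e j vQ) ∧ U ⊆ H}) (H₀ := box p e j vQ K)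
      ⟨⟨K, rfl⟩, hK⟩ ?_).symm⟩
    rintro H ⟨⟨k, rfl⟩, hUH⟩
    exact box_mono j vQ (hmax k hUH)

variable {p e}

/-- **The hull of a bounded set is the box `box K` with `U ⊆ box K`, `U ⊄ box (K+1)`.** [folklore] -/
theorem hull_eq_box [Fact p.Prime] {j : toyIndex.Label} {vQ : toyIndex.VQ} {U : Set ((ramShellsE p e).Packet j vQ)} {K : ℤ}
    (hK : U ⊆ box p e j vQ K) (hK' : ¬ U ⊆ box p e j vQ (K + 1)) : (rFrame p e j vQ).hull U = box p e j vQ K := by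
  unfold HullFrame.hull
  rw [if_pos (show (rFrame p e j vQ).IsBounded U from ⟨K, hK⟩)]
  refine sInter_eq_of_least (S := {H | H ∈ (rFrame p e j vQ).Hul ∧ U ⊆ H}) ⟨⟨K, rfl⟩, hK⟩ ?_
  rintro H ⟨⟨k, rfl⟩, hUH⟩
  refine box_mono j vQ ?_
  by_contra h
  exact hK' (hUH.trans (box_mono j vQ (by omega)))

/-- The hull of a box is itself (`e ≥ 1`). [folklore] -/
theorem rFrame_hull_box [Fact p.Prime] [NeZero e] (j : toyIndex.Label) (vQ : toyIndex.VQ) (k : ℤ) :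
    (rFrame p e j vQ).hull (box p e j vQ k) = box p e j vQ k :=
  hull_eq_box subset_rfl fun h => by have := (box_subset_iff j vQ k (k + 1)).1 h; omega

/-- A box is bounded and admits its hull (`e ≥ 1`). [folklore] -/
theorem rFrame_bounded_hasHull [Fact p.Prime] [NeZero e] (j : toyIndex.Label) (vQ : toyIndex.VQ) (k : ℤ) :
    (rFrame p e j vQ).IsBounded (box p e j vQ k) ∧ (rFrame p e j vQ).HasHull (box p e j vQ k) := by
  have he : 0 < (e : ℤ) := by exact_mod_cast Nat.pos_of_ne_zero (NeZero.ne e)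
  refine ⟨⟨k, subset_rfl⟩, (p : ℚ) ^ (max k 0) • tb p e j vQ (zeros e j),
    (ppow_smul_tb_mem_box_iff _ _ _).2 ?_, ppow_smul_tb_ne_zero j vQ (max k 0) (zeros e j)⟩
  rw [wt_zeros]
  push_cast
  nlinarith [le_max_left k 0, le_max_right k 0]

variable (p e)

open scoped Classical in
/-- The LOG-VOLUME of the ramified bed of index `e`: `μ(box k) = −(k/e)·log p` on boxes (`μ(𝒪_L) = 0`, `μ(p·𝒪_L) = μ(box e) = −log p`:
the packet-normalised log-volume of [IUTchIII] Prop. 3.9 (i)–(ii), one `π`-step = `(1/e)·log p`), `0` on non-boxes (never evaluated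
there). [claim: Mochizuki2012, status: disputed] -/
def rVol (j : toyIndex.Label) (vQ : toyIndex.VQ) (A : Set ((ramShellsE p e).Packet j vQ)) : ℝ :=
  if h : ∃ k, A = box p e j vQ k then -((h.choose : ℝ) / e) * Real.log p else 0

/-- `μ(box k) = −(k/e)·log p` (`e ≥ 1`). [folklore] -/
theorem rVol_box [Fact p.Prime] [NeZero e] (j : toyIndex.Label) (vQ : toyIndex.VQ) (k : ℤ) :
    rVol p e j vQ (box p e j vQ k) = -((k : ℝ) / e) * Real.log p := by
  classical
  have h : ∃ k', box p e j vQ k = box p e j vQ k' := ⟨k, rfl⟩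
  unfold rVol
  rw [dif_pos h, box_injective j vQ h.choose_spec.symm]

/-- The log-volume is monotone on boxes (`e ≥ 1`). [folklore] -/
theorem rVol_mono [Fact p.Prime] [NeZero e] {j : toyIndex.Label} {vQ : toyIndex.VQ} {k k' : ℤ}
    (h : box p e j vQ k ⊆ box p e j vQ k') : rVol p e j vQ (box p e j vQ k) ≤ rVol p e j vQ (box p e j vQ k') := by
  rw [rVol_box, rVol_box]
  have hk : (k' : ℝ) ≤ k := by exact_mod_cast (box_subset_iff j vQ k k').1 h
  have he : (0 : ℝ) < e := by exact_mod_cast Nat.pos_of_ne_zero (NeZero.ne e)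
  have hL := log_p_pos p
  have h1 : (k' : ℝ) / e ≤ k / e := div_le_div_of_nonneg_right hk he.le
  nlinarith

end Summit.ABC.IUTFork.Cor312Vol.RamifiedEWitness

end
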